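import Summits.ABC.ABC.Theorems.DefiniteXiFreyModularityStubAbsIrrNegThree
import Summits.ABC.ABC.Theorems.DefiniteXiFreyModularityStubFreySwanOdd
import Summits.ABC.ABC.Theorems.DefiniteXiFreyModularityStubSwanOddNonabelian
import Summits.ABC.ABC.Theorems.DefiniteXiFreyModularityStubFreyFiveIrreducibleGlue
import Literature.NumberTheory.DiophantineGeometry.GeneralizedFermatTwoPowerCoefficientMazurTorsionProofs
import HarnessLib

/-!
# Crux `FreyModularity` (stmt-ABC-11340), line `Sketch`: case B forces `16 ∣ B` —
# the additive Frey classes have `ρ̄_{E,3}|_{ℚ(√-3)}` absolutely irreducible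

Support file for the crux `Summit.ABC.ABC.Theses.DefiniteXi.FreyModularity` (every Frey curve
`E_(a,b) : y² = x(x - a)(x + b)` is modular), line `Sketch`, registered stub `stub_freyCaseBSixteen`
(reshape 6, lead `c50`).  The composition of the line (Conrad–Diamond–Taylor 1999, proof of
Thm. 7.1.2, p. 556) splits on **case A** — some framed model of `E[3]` is absolutely irreducible
over `ℚ(√-3)` (lifting at `3`) — versus **case B** (Wiles' `3`–`5` switch and lifting at `5`).
This file proves that on the normalised Frey family (`A ≡ -1 (mod 4)`, `2 ∣ B`; Diamond–Kramer
1995, Lemma 1) **case B forces `16 ∣ B`**, i.e. every additive Frey class (`ord₂ B ∈ {1, 2, 3}`)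
is in case A; so the switch is only ever needed for Frey curves semistable at every prime:

* `sq_eq_one_or_pow_eight_of_det_eq_neg_one`, `exists_pow_eight_word` — in `GL₂(𝔽₃)` an element
  of determinant `-1` is a reflection or has order `8` (a finite check over `M₂(𝔽₃)`); hence two
  non-commuting elements `a, b` of `SL₂(𝔽₃)` and an involution `k` of determinant `-1` give an
  element of order `8` among `ka, kb, kab` (were all three reflections, conjugation by `k` would
  invert `a`, `b` and `ab`, forcing `ab = ba`);
* `exists_orderOf_eq_eight_of_inertia_noncomm` — for `E/ℚ` and a framed model `ρ̄` of `E[3]`: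
  two elements of an inertia group above `2` acting on `E[3]` without commuting yield `σ` with
  `ρ̄(σ)` of order `8` (inertia above `2` lies in `SL₂(𝔽₃)` as `det ρ̄ = χ̄₃` is unramified at
  `2`; complex conjugation supplies `k`);
* `isAbsIrreducibleOverSqrt_negThree_of_swanConductorAt_odd` — with the parity stub S11
  (`stub_swanOddNonabelianInertia`: odd `Sw_𝔓(E[3])` ⇒ non-abelian inertia action) and R3's
  criterion `isAbsIrreducibleOverSqrt_negThree_of_orderOf_eq_eight`: an odd Swan conductor of
  `E[3]` above `2` puts `E` in case A;
* `sixteen_dvd_of_caseB_of_swanOddNonabelian` / the stub — on the Frey family: if `16 ∤ B` then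
  either `3 ∤ abc` (R3, `isAbsIrreducibleOverSqrt_negThree_freyCurve_of_not_three_dvd`; this
  covers the corner `2A + B = 0`, `E_(-1,2)`) or `Sw_𝔓(E[5]) ∈ {1, 3}` above `2`
  (`stub_freySwanOdd`, Diamond–Kramer Lemma 2) and `Sw_𝔓(E[3]) = Sw_𝔓(E[5])`
  (`swanConductorAt_torsion_eq_swanConductorAt_torsion`), hence case A — contradiction.

The parity input S11 is kept as an explicit hypothesis in `…_of_swanOddNonabelian` and supplied
by the landed sibling `…StubSwanOddNonabelian` (`stub_swanOddNonabelianInertia`, p157517) in the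
stub proper.  Nothing is defined; no named fact is used.

## References

* [DiamondKramer1995] F. Diamond, K. Kramer, Math. Res. Lett. 2 (1995), 299–304, Lemmas 1–3
  and the remark after Lemma 3.
* [Ribet1997] K. A. Ribet, Acta Arith. 79 (1997), proof of Prop. 1 (pp. 11–12): "the action of
  `I` on `E[l]` is irreducible if `l ≥ 3`".
* [ConradDiamondTaylor1999] B. Conrad, F. Diamond, R. Taylor, J. Amer. Math. Soc. 12 (1999),
  proof of Thm. 7.1.2 (p. 556).
* [Serre1972] J.-P. Serre, Invent. Math. 15 (1972), §2.5–2.6 (subgroups of `GL₂(𝔽₃)`).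
-/

-- `Summit.<Summit>.<Problem>` is the mandated summit-side namespace (CONVENTIONS §2); for the
-- single-conjunct summit `ABC` the two coincide, so the duplicate `ABC.ABC` is deliberate.
set_option linter.dupNamespace false

noncomputable section

open scoped MatrixGroups NumberField

open Matrix Field IsDedekindDomain
open Literature.NumberTheory.EllipticCurves
open Literature.NumberTheory.Automorphic
open Literature.NumberTheory.Automorphic.BCDT
open Literature.NumberTheory.GaloisRepresentations
open Literature.NumberTheory.DiophantineGeometry
open WeierstrassCurve

attribute [local instance] AddSubgroup.torsionBy.zmodModule

namespace Summit.ABC.ABC.Theorems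

/-! ## `GL₂(𝔽₃)`: elements of determinant `-1`, and a commutator argument -/

/-- **An element of `GL₂(𝔽₃)` of determinant `-1` is a reflection or has order `8`.**  For
`g ∈ M₂(𝔽₃)` with `det g = -1`: either `g² = 1` (trace `0`), or `g⁸ = 1 ≠ g⁴` (trace `±1`: the
characteristic polynomial `X² ∓ X - 1` is irreducible and its roots in `𝔽₉` have order `8`).
Proved as a finite check over the `3⁴` matrices. [folklore] -/
theorem sq_eq_one_or_pow_eight_of_det_eq_neg_one (g : Matrix (Fin 2) (Fin 2) (ZMod 3))
    (hg : g.det = -1) : g ^ 2 = 1 ∨ (g ^ 8 = 1 ∧ g ^ 4 ≠ 1) := by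
  obtain ⟨p, q, r, s, rfl⟩ : ∃ p q r s : ZMod 3, g = !![p, q; r, s] :=
    ⟨_, _, _, _, Matrix.eta_fin_two g⟩
  rw [Matrix.det_fin_two_of] at hg
  revert p q r s
  decide +kernel

/-- **Two non-commuting elements of `SL₂(𝔽₃)` and an involution of determinant `-1` produce an
element of order `8`.**  If `a, b ∈ M₂(𝔽₃)` have determinant `1` and do not commute, and `k` is an
involution with `det k = -1`, then one of `k a`, `k b`, `k a b` satisfies `w⁸ = 1 ≠ w⁴`.  Indeed
each of them has determinant `-1`, hence is a reflection or has order `8`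
(`sq_eq_one_or_pow_eight_of_det_eq_neg_one`); if all three were reflections, conjugation by `k`
would invert `a`, `b` and `a b`, so `(ab)⁻¹ = a⁻¹ b⁻¹ = b⁻¹ a⁻¹ ∘` — i.e. `a` and `b` would
commute. [folklore] -/
theorem exists_pow_eight_word (a b k : Matrix (Fin 2) (Fin 2) (ZMod 3)) (ha : a.det = 1)
    (hb : b.det = 1) (hab : a * b ≠ b * a) (hk : k ^ 2 = 1) (hkd : k.det = -1) :
    ((k * a) ^ 8 = 1 ∧ (k * a) ^ 4 ≠ 1) ∨ ((k * b) ^ 8 = 1 ∧ (k * b) ^ 4 ≠ 1) ∨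
      ((k * a * b) ^ 8 = 1 ∧ (k * a * b) ^ 4 ≠ 1) := by
  have hkk : k * k = 1 := by rw [← sq]; exact hk
  have hda : (k * a).det = -1 := by rw [det_mul, hkd, ha, mul_one]
  have hdb : (k * b).det = -1 := by rw [det_mul, hkd, hb, mul_one]
  have hdab : (k * a * b).det = -1 := by rw [det_mul, det_mul, hkd, ha, hb, mul_one, mul_one]
  rcases sq_eq_one_or_pow_eight_of_det_eq_neg_one (k * a) hda with h1 | h1
  swap; · exact Or.inl h1
  rcases sq_eq_one_or_pow_eight_of_det_eq_neg_one (k * b) hdb with h2 | h2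
  swap; · exact Or.inr (Or.inl h2)
  rcases sq_eq_one_or_pow_eight_of_det_eq_neg_one (k * a * b) hdab with h3 | h3
  swap; · exact Or.inr (Or.inr h3)
  -- all three are involutions: `k a k = a⁻¹`, `k b k = b⁻¹`, `k a b k = (a b)⁻¹`, so `a b = b a`
  exfalso
  apply hab
  have h1' : k * a * k * a = 1 := by rw [sq] at h1; simpa only [mul_assoc] using h1
  have h2' : k * b * k * b = 1 := by rw [sq] at h2; simpa only [mul_assoc] using h2
  have h3' : k * a * b * k * a * b = 1 := by rw [sq] at h3; simpa only [mul_assoc] using h3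
  -- two-sided inverses
  have haa' : a * (k * a * k) = 1 := mul_eq_one_comm.mp h1'
  have hbb' : b * (k * b * k) = 1 := mul_eq_one_comm.mp h2'
  have key : k * a * k * (k * b * k) * (a * b) = 1 := by
    have h : k * a * k * (k * b * k) * (a * b) = k * a * (k * k) * b * k * a * b := by
      simp only [mul_assoc]
    rw [h, hkk, mul_one, h3']
  calc a * b = b * (k * b * k) * (a * b) := by rw [hbb', one_mul]
    _ = b * (a * (k * a * k)) * (k * b * k) * (a * b) := by rw [haa', mul_one]
    _ = b * a * (k * a * k * (k * b * k) * (a * b)) := by simp only [mul_assoc]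
    _ = b * a := by rw [key, mul_one]

/-! ## From a non-abelian inertia action above `2` to an element of order `8` -/

/-- The non-trivial unit of `𝔽₃` is `2 = -1`. [folklore] -/
theorem val_eq_two_of_ne_one : ∀ w : (ZMod 3)ˣ, w ≠ 1 → (w : ZMod 3).val = 2 := by decide

/-- **Inertia above `2` acts on `E[3]` with determinant `1`**: for `σ ∈ I_𝔓`, `𝔓 ∣ 2`, and a
framed model `ρ̄` of `E[3]`, `det ρ̄(σ) = χ̄₃(σ) = 1` — the Weil pairing
(`det_eq_modPCyclotomicCharacter_of_isTorsionGaloisRep_holds`) and the fact that inertia above `2`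
fixes the cube roots of unity (`smul_eq_self_of_mem_inertia_of_pow_prime_pow_eq_one`).
[folklore] -/
theorem det_eq_one_of_mem_inertia_two (W : WeierstrassCurve ℚ) [W.IsElliptic]
    {v : HeightOneSpectrum (𝓞 ℚ)} (hv2 : (2 : 𝓞 ℚ) ∈ v.asIdeal)
    {𝔓 : Ideal (absIntegers (𝓞 ℚ) ℚ)} (h𝔓 : 𝔓 ∈ v.primesAbove)
    {ρ : ModPGaloisRep ℚ (ZMod 3) 2} (hρ : W.IsTorsionGaloisRep 3 ρ)
    {σ : absoluteGaloisGroup ℚ} (hσ : σ ∈ 𝔓.inertia (absoluteGaloisGroup ℚ)) :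
    ((ρ σ : GL (Fin 2) (ZMod 3)) : Matrix (Fin 2) (Fin 2) (ZMod 3)).det = 1 := by
  haveI : Fact (Nat.Prime 3) := ⟨Nat.prime_three⟩
  have hdet := W.det_eq_modPCyclotomicCharacter_of_isTorsionGaloisRep_holds 3 ρ hρ σ
  have h1 : ((Matrix.GeneralLinearGroup.det (ρ σ) : (ZMod 3)ˣ) : ZMod 3) =
      ((ρ σ : GL (Fin 2) (ZMod 3)) : Matrix (Fin 2) (Fin 2) (ZMod 3)).det :=
    Matrix.GeneralLinearGroup.val_det_apply (ρ σ)
  rw [← h1, hdet]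
  -- `χ̄₃(σ) = 1`: `σ` fixes a primitive cube root of unity
  obtain ⟨ζ, hζ⟩ := HasEnoughRootsOfUnity.exists_primitiveRoot (AlgebraicClosure ℚ) 3
  have hζ3 : ζ ^ 3 = 1 := hζ.pow_eq_one
  have hv3 : ((3 : ℕ) : 𝓞 ℚ) ∉ v.asIdeal := natCast_not_mem_asIdeal_of_odd hv2 (by decide)
  have hfix : σ • ζ = ζ :=
    smul_eq_self_of_mem_inertia_of_pow_prime_pow_eq_one (K := ℚ) (ℓ := 3) hv3 h𝔓 hσ (n := 1)
      (by rw [pow_one]; exact hζ3)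
  set u := modPCyclotomicCharacterZMod ℚ 3 σ with hu
  have hspec : σ • ζ = ζ ^ (u : ZMod 3).val := modPCyclotomicCharacterZMod_spec ℚ 3 σ ζ hζ3
  by_contra hne
  have hne' : u ≠ 1 := fun h ↦ hne (by rw [h, Units.val_one])
  have hval : (u : ZMod 3).val = 2 := val_eq_two_of_ne_one u hne'
  rw [hfix, hval] at hspec
  -- `ζ = ζ²` forces `ζ ∈ {0, 1}`, impossible for a primitive cube root
  have hζ1 : ζ ≠ 1 := hζ.ne_one (by norm_num)
  have hζ0 : ζ ≠ 0 := fun h ↦ by rw [h] at hζ3; norm_num at hζ3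
  have h2 : ζ * (ζ - 1) = 0 := by linear_combination (-1 : AlgebraicClosure ℚ) * hspec
  rcases mul_eq_zero.mp h2 with h | h
  · exact hζ0 h
  · exact hζ1 (sub_eq_zero.mp h)

/-- **Two inertia elements above `2` acting on `E[3]` without commuting give an element of order
`8` in the image of `ρ̄_{E,3}`.**  Let `a = ρ̄(σ₁)`, `b = ρ̄(σ₂)` (determinant `1`,
`det_eq_one_of_mem_inertia_two`; non-commuting since the frame `E[3] ≃ 𝔽₃²` is `Γ_ℚ`-equivariant)
and `k = ρ̄(c)` for a complex conjugation `c` (`k² = 1`, `det k = χ̄₃(c) = -1`).  By the finite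
check `exists_pow_eight_word`, one of `ρ̄(cσ₁)`, `ρ̄(cσ₂)`, `ρ̄(cσ₁σ₂)` has order `8`.
[cite: Serre1972, §2.6 (subgroups of GL₂(𝔽₃))] -/
theorem exists_orderOf_eq_eight_of_inertia_noncomm (W : WeierstrassCurve ℚ) [W.IsElliptic]
    {v : HeightOneSpectrum (𝓞 ℚ)} (hv2 : (2 : 𝓞 ℚ) ∈ v.asIdeal)
    {𝔓 : Ideal (absIntegers (𝓞 ℚ) ℚ)} (h𝔓 : 𝔓 ∈ v.primesAbove)
    {σ₁ σ₂ : absoluteGaloisGroup ℚ} (hσ₁ : σ₁ ∈ 𝔓.inertia (absoluteGaloisGroup ℚ))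
    (hσ₂ : σ₂ ∈ 𝔓.inertia (absoluteGaloisGroup ℚ))
    (hne : ∃ T : geomTorsion W (3 : ℕ), (σ₁ * σ₂) • T ≠ (σ₂ * σ₁) • T)
    {ρ : ModPGaloisRep ℚ (ZMod 3) 2} (hρ : W.IsTorsionGaloisRep 3 ρ) :
    ∃ σ : absoluteGaloisGroup ℚ, orderOf (ρ σ) = 8 := by
  haveI : Fact (Nat.Prime 3) := ⟨Nat.prime_three⟩
  -- the matrices `A g = ρ̄(g)`
  set A : absoluteGaloisGroup ℚ → Matrix (Fin 2) (Fin 2) (ZMod 3) :=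
    fun g ↦ ((ρ g : GL (Fin 2) (ZMod 3)) : Matrix (Fin 2) (Fin 2) (ZMod 3)) with hA
  have hAmul : ∀ g h, A (g * h) = A g * A h := fun g h ↦ by
    simp only [hA, map_mul, Units.val_mul]
  have hApow : ∀ g (n : ℕ), A (g ^ n) = A g ^ n := fun g n ↦ by
    simp only [hA, map_pow, Units.val_pow_eq_pow_val]
  -- order `8` from `A⁸ = 1 ≠ A⁴`
  have horder : ∀ g, A g ^ 8 = 1 → A g ^ 4 ≠ 1 → orderOf (ρ g) = 8 := by
    intro g h8 h4
    have h8' : (ρ g) ^ 2 ^ (2 + 1) = 1 := by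
      rw [← Units.val_eq_one, Units.val_pow_eq_pow_val]
      exact h8
    have h4' : ¬ (ρ g) ^ 2 ^ 2 = 1 := by
      intro h1
      apply h4
      have h2 := congrArg (fun u : GL (Fin 2) (ZMod 3) ↦ (u : Matrix (Fin 2) (Fin 2) (ZMod 3))) h1
      simp only [Units.val_pow_eq_pow_val, Units.val_one] at h2
      exact h2
    have := orderOf_eq_prime_pow h4' h8'
    simpa using this
  -- `a = A σ₁`, `b = A σ₂` have determinant `1` and do not commute
  have ha : (A σ₁).det = 1 := det_eq_one_of_mem_inertia_two W hv2 h𝔓 hρ hσ₁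
  have hb : (A σ₂).det = 1 := det_eq_one_of_mem_inertia_two W hv2 h𝔓 hρ hσ₂
  have hab : A σ₁ * A σ₂ ≠ A σ₂ * A σ₁ := by
    intro heq
    obtain ⟨T, hT⟩ := hne
    obtain ⟨e, he⟩ := hρ
    apply hT
    apply e.injective
    rw [he, he]
    change A (σ₁ * σ₂) *ᵥ e T = A (σ₂ * σ₁) *ᵥ e T
    rw [hAmul, hAmul, heq]
  -- complex conjugation: `k = A c₀`, `k² = 1`, `det k = -1`
  obtain ⟨c₀, hc₀⟩ := exists_isComplexConjugation (Rat.castHom ℝ)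
  have hk2 : A c₀ ^ 2 = 1 := by
    rw [← hApow, hc₀.sq_eq_one]
    simp only [hA, map_one, Units.val_one]
  have hdet := W.det_eq_modPCyclotomicCharacter_of_isTorsionGaloisRep_holds 3 ρ hρ
  have hkd : (A c₀).det = -1 := by
    have h1 := congrArg (fun u : (ZMod 3)ˣ ↦ (u : ZMod 3)) (hdet c₀)
    simp only [Matrix.GeneralLinearGroup.val_det_apply] at h1
    rw [hA, h1, modPCyclotomicCharacterZMod_eq_modNCyclotomicCharacter]
    exact modNCyclotomicCharacter_of_isComplexConjugation (N := 3) hc₀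
  -- the finite check
  rcases exists_pow_eight_word (A σ₁) (A σ₂) (A c₀) ha hb hab hk2 hkd with h | h | h
  · exact ⟨c₀ * σ₁, horder _ (by rw [hAmul]; exact h.1) (by rw [hAmul]; exact h.2)⟩
  · exact ⟨c₀ * σ₂, horder _ (by rw [hAmul]; exact h.1) (by rw [hAmul]; exact h.2)⟩
  · exact ⟨c₀ * σ₁ * σ₂, horder _ (by rw [hAmul, hAmul]; exact h.1)
      (by rw [hAmul, hAmul]; exact h.2)⟩

/-- **An odd Swan conductor of `E[3]` above `2` puts `E` in case A**, granted the parity stub S11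
(`stub_swanOddNonabelianInertia`, hypothesis `hS11`): S11 gives two non-commuting inertia elements,
`exists_orderOf_eq_eight_of_inertia_noncomm` an element of order `8` in the image of any framed
model `ρ̄` of `E[3]`, and R3's criterion (`isAbsIrreducibleOverSqrt_negThree_of_orderOf_eq_eight`,
with `det ρ̄ = χ̄₃`) the absolute irreducibility of `ρ̄|_{ℚ(√-3)}`.
[cite: DiamondKramer1995, remark after Lemma 3] [cite: Ribet1997, Prop. 1 (proof, pp. 11–12)] -/
theorem isAbsIrreducibleOverSqrt_negThree_of_swanConductorAt_odd
    (hS11 : ∀ (W : WeierstrassCurve ℚ) [W.IsElliptic] (v : HeightOneSpectrum (𝓞 ℚ)),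
      (2 : 𝓞 ℚ) ∈ v.asIdeal → ∀ 𝔓 ∈ v.primesAbove,
      (¬ ∃ n : ℕ, (W.torsionGaloisRep 3).swanConductorAt (𝓞 ℚ) 𝔓 = 2 * n) →
      ∃ σ₁ ∈ 𝔓.inertia (Field.absoluteGaloisGroup ℚ), ∃ σ₂ ∈ 𝔓.inertia (Field.absoluteGaloisGroup ℚ),
        ∃ T : geomTorsion W (3 : ℕ), (σ₁ * σ₂) • T ≠ (σ₂ * σ₁) • T)
    (W : WeierstrassCurve ℚ) [W.IsElliptic]
    {v : HeightOneSpectrum (𝓞 ℚ)} (hv2 : (2 : 𝓞 ℚ) ∈ v.asIdeal)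
    {𝔓 : Ideal (absIntegers (𝓞 ℚ) ℚ)} (h𝔓 : 𝔓 ∈ v.primesAbove)
    (hodd : ¬ ∃ n : ℕ, (W.torsionGaloisRep 3).swanConductorAt (𝓞 ℚ) 𝔓 = 2 * n)
    {ρ : ModPGaloisRep ℚ (ZMod 3) 2} (hρ : W.IsTorsionGaloisRep 3 ρ) :
    ρ.IsAbsIrreducibleOverSqrt (-3) := by
  haveI : Fact (Nat.Prime 3) := ⟨Nat.prime_three⟩
  obtain ⟨σ₁, hσ₁, σ₂, hσ₂, hT⟩ := hS11 W v hv2 𝔓 h𝔓 hodd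
  obtain ⟨σ, hσ⟩ := exists_orderOf_eq_eight_of_inertia_noncomm W hv2 h𝔓 hσ₁ hσ₂ hT hρ
  exact isAbsIrreducibleOverSqrt_negThree_of_orderOf_eq_eight ρ
    (W.det_eq_modPCyclotomicCharacter_of_isTorsionGaloisRep_holds 3 ρ hρ) hσ

/-! ## The Frey family: case B forces `16 ∣ B` -/

/-- **Case B forces `16 ∣ B`, granted S11** (hypothesis `hS11`, the statement of
`stub_swanOddNonabelianInertia`).  For coprime `A, B` with `AB(A+B) ≠ 0`, `A ≡ -1 (mod 4)`,
`2 ∣ B` and no framed model of `E_(A,B)[3]` absolutely irreducible over `ℚ(√-3)`: if `16 ∤ B`,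
then `3 ∣ abc` (else R3, `isAbsIrreducibleOverSqrt_negThree_freyCurve_of_not_three_dvd`, gives
case A), so `2A + B ≠ 0` (`not_three_dvd_of_two_mul_add_eq_zero`, landed with the reshape-3 glue), and Diamond–Kramer's table
(`stub_freySwanOdd`) gives a prime `𝔓 ∣ 2` with `Sw_𝔓(E[5]) ∈ {1, 3}`; by `ℓ`-independence
(`swanConductorAt_torsion_eq_swanConductorAt_torsion`) `Sw_𝔓(E[3])` is odd, and
`isAbsIrreducibleOverSqrt_negThree_of_swanConductorAt_odd` puts `E` in case A — contradiction.
[cite: DiamondKramer1995, Lemmas 1–3] [cite: Ribet1997, Prop. 1 (proof, pp. 11–12)] -/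
theorem sixteen_dvd_of_caseB_of_swanOddNonabelian
    (hS11 : ∀ (W : WeierstrassCurve ℚ) [W.IsElliptic] (v : HeightOneSpectrum (𝓞 ℚ)),
      (2 : 𝓞 ℚ) ∈ v.asIdeal → ∀ 𝔓 ∈ v.primesAbove,
      (¬ ∃ n : ℕ, (W.torsionGaloisRep 3).swanConductorAt (𝓞 ℚ) 𝔓 = 2 * n) →
      ∃ σ₁ ∈ 𝔓.inertia (Field.absoluteGaloisGroup ℚ), ∃ σ₂ ∈ 𝔓.inertia (Field.absoluteGaloisGroup ℚ),
        ∃ T : geomTorsion W (3 : ℕ), (σ₁ * σ₂) • T ≠ (σ₂ * σ₁) • T) :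
    ∀ (A B : ℤ) [(freyCurve A B).IsElliptic], IsCoprime A B → A * B * (A + B) ≠ 0 →
      A ≡ -1 [ZMOD 4] → (2 : ℤ) ∣ B →
      (∀ ρ₃ : ModPGaloisRep ℚ (ZMod 3) 2, (freyCurve A B).IsTorsionGaloisRep 3 ρ₃ →
        ¬ ρ₃.IsAbsIrreducibleOverSqrt (-3)) →
      (16 : ℤ) ∣ B := by
  intro A B _ hcop h0 hA h2 hB
  haveI : Fact (Nat.Prime 3) := ⟨Nat.prime_three⟩
  haveI : Fact (Nat.Prime 5) := ⟨Nat.prime_five⟩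
  -- a framed model of `E[3]`
  obtain ⟨ρ, hρ⟩ := (freyCurve A B).exists_isTorsionGaloisRep 3
  by_contra h16
  -- `3 ∣ abc`, otherwise R3 gives case A
  by_cases h3 : (3 : ℤ) ∣ A * B * (A + B)
  swap
  · exact hB ρ hρ (isAbsIrreducibleOverSqrt_negThree_freyCurve_of_not_three_dvd A B hcop h0 h3 ρ hρ)
  have h2AB : 2 * A + B ≠ 0 := fun h ↦ not_three_dvd_of_two_mul_add_eq_zero hcop h h3
  -- Diamond–Kramer: `Sw_𝔓(E[5]) ∈ {1, 3}` above `2`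
  obtain ⟨v, 𝔓, hv2, h𝔓, hSw⟩ := stub_freySwanOdd A B hcop h0 hA h2 h16 h2AB
  have hv3 : ((3 : ℕ) : 𝓞 ℚ) ∉ v.asIdeal := natCast_not_mem_asIdeal_of_odd hv2 (by decide)
  have hv5 : ((5 : ℕ) : 𝓞 ℚ) ∉ v.asIdeal := natCast_not_mem_asIdeal_of_odd hv2 (by decide)
  have hℓ := (freyCurve A B).swanConductorAt_torsion_eq_swanConductorAt_torsion 3 5 hv3 hv5 h𝔓
  -- `Sw_𝔓(E[3])` is odd
  have hodd : ¬ ∃ n : ℕ, ((freyCurve A B).torsionGaloisRep 3).swanConductorAt (𝓞 ℚ) 𝔓 = 2 * n := by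
    rintro ⟨n, hn⟩
    rw [hℓ] at hn
    rcases hSw with h | h <;> rw [h] at hn
    · have h' : (1 : ℕ) = 2 * n := by exact_mod_cast hn
      omega
    · have h' : (3 : ℕ) = 2 * n := by exact_mod_cast hn
      omega
  exact hB ρ hρ (isAbsIrreducibleOverSqrt_negThree_of_swanConductorAt_odd hS11 (freyCurve A B)
    hv2 h𝔓 hodd hρ)

/-- **Registered stub `stub_freyCaseBSixteen` (crux `FreyModularity`, line `Sketch`, S12): on the
normalised Frey family, case B forces `16 ∣ B`.**  For coprime `A, B` with `AB(A+B) ≠ 0`,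
`A ≡ -1 (mod 4)`, `2 ∣ B`: if no framed model of `E_(A,B)[3]` is absolutely irreducible over
`ℚ(√-3)`, then `16 ∣ B` — so every Frey curve in case B of the composition is semistable at every
prime (Diamond–Kramer 1995, Lemma 2: `16 ∣ B` ⇒ good or multiplicative reduction at `2`), and
Wiles' `3`–`5` switch is only ever invoked on semistable Frey curves.
`sixteen_dvd_of_caseB_of_swanOddNonabelian` with S11 = `stub_swanOddNonabelianInertia`.
[cite: DiamondKramer1995, Lemmas 1–3 and remark after Lemma 3]
[cite: Ribet1997, Prop. 1 (proof, pp. 11–12)] -/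
theorem stub_freyCaseBSixteen :
    ∀ (A B : ℤ) [(freyCurve A B).IsElliptic], IsCoprime A B → A * B * (A + B) ≠ 0 →
      A ≡ -1 [ZMOD 4] → (2 : ℤ) ∣ B →
      (∀ ρ₃ : ModPGaloisRep ℚ (ZMod 3) 2, (freyCurve A B).IsTorsionGaloisRep 3 ρ₃ →
        ¬ ρ₃.IsAbsIrreducibleOverSqrt (-3)) →
      (16 : ℤ) ∣ B :=
  sixteen_dvd_of_caseB_of_swanOddNonabelian stub_swanOddNonabelianInertia

end Summit.ABC.ABC.Theorems

end
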